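import Mathlib
import HarnessLib
import Summits.HubbardSuperconductivity.HubbardSuperconductivity.Theorems.KLProgrammeKLRegimeEngineStepValuesResidueV17F2
import Summits.HubbardSuperconductivity.HubbardSuperconductivity.Theorems.KLProgrammeKLRegimeEngineBareBallDiagonalPoint
import Summits.HubbardSuperconductivity.HubbardSuperconductivity.Theorems.KLProgrammeKLRegimeEngineV8DefsQ7
import Summits.HubbardSuperconductivity.HubbardSuperconductivity.Theorems.KLProgrammeKLRegimeEngineV8DefsU9

/-!
# K3 ENGINE-FLOW child (gen 8, stmt-HubbardSuperconductivity-20437 `KLRegimeEngineV17F2`), stub (c) `stub_engine_step_values`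
# AT THE REGISTERED TOKENS `(klEngGeo7, klEngQ7 P R, klEngC₃6, klEngU₀9)` — the residual forms BY NAME
# (cell gate-hubbard-kl, seat hubbard-kl-k3c2-p2 g8, value/(T) lane; plan g17 (R44) «(c) closers … lift to Q7 after registration»)

`klEngQ7 P R = (klEngQ6 P R).raiseCEOnly (klWtCE R)` (k3c2-p1 g4, `…EngineV8DefsQ7`) moves `CE` only, so `(klEngQ7 P R).CR = (klEngQ5 P R).CR`
by `rfl` and every value clause at `klEngQ7` IS the one at `klEngQ6` (`…_klEngQ7_iff`, `Iff.rfl`); `klEngU₀9 ≤ klEngU₀4` (`…DefsU9`).  Hence the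
`Q`-generic residual forms of `…EngineStepValuesResidueV17F2` instantiate at the registered text.  Binders below are the STUB's, in the stub's order
(the ones the value lane does not read are `_`-prefixed), followed by the residual inputs:

* **`stepValuesV17F2_reg_of_residue`** — stub (c) ⇐ (E2-F2)ₙ `hlad` + OUT-OF-CLASS cross-frame rows `hout` + (E5-F)ₙ `hE5`;
* **`stepValuesV17F2_reg_of_residue_towerLine`** — stub (c) ⇐ `hlad` + `hout` + the tower's single iso-tuple line `hfix` (`2a ≤ klEngGeo7.CF`, `b ≤ CF`)
  + `R.Gfr 0·|U| ≤ klE0/32` + the accumulated-rows smallness; the bare-ball diagonal point of `…EngineBareBallDiagonalPoint` supplies the door's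
  geometry from `μ ∈ klWindowC`, `klEngL₃ β U ≤ L`;
* `stepValuesV17F2_of_residue_towerLineLinear_Q` / **`stepValuesV17F2_reg_of_residue_towerLineLinear`** — the same with the LINEAR
  (E5-F)ₙ door ((R46)(β): `a + b·Klam²·U ≤ CF/2`);
* **`stepValuesV17F2_reg_band_of_signBlind`** / **`stepValuesV17F2_reg_band_towerLine`** — the thermal band `nScales β ≤ n + T`: ONE sign-blind
  cross-frame bound `Cp·(Klam U)²` (`Cp·4^T ≤ 2^80`) + (E5-F)ₙ, resp. + the door inputs.

Bookkeeping only; nothing about the model is asserted; nothing asserts superconductivity.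
-/

noncomputable section

namespace Summit.HubbardSuperconductivity.HubbardSuperconductivity.Theorems.KLRegimeSplit

set_option linter.dupNamespace false -- summit = problem name (single-conjunct summit), D-0017

open Real Finset Literature.MathematicalPhysics.QuantumLattice Literature.Probability.LatticeModels
open Summit.HubbardSuperconductivity.HubbardSuperconductivity.Theorems.KLProgrammeLegKernels
open Summit.HubbardSuperconductivity.HubbardSuperconductivity.Theorems.EngineV8
open Summit.HubbardSuperconductivity.HubbardSuperconductivity.Theorems.DispersionFlow

/-- **Stub (c) of the registered 20437 skeleton from its three residual inputs** (stub binders, then `hlad`, `hout`, `hE5`). -/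
theorem stepValuesV17F2_reg_of_residue (P : SplitConsts) (R : RenConsts) (c : ℝ) (hP : P.WF) (hR : R.WF2) (_hc : 0 < c)
    (_hc3 : c ≤ klEngC₃6 P R) (μ : ℝ) (_hμ : μ ∈ klWindowC) (U : ℝ) (hU : 0 < U) (hUle : U ≤ klEngU₀9 P R c) (β : ℝ)
    (_hβ : klBetaMin ≤ β) (_hβc : β ≤ Real.exp (c / U ^ 2)) (L M : ℕ) [NeZero L] [NeZero M] (_hL : klEngL₃ β U ≤ L)
    (_hM : klEngM₃ β U L ≤ M) (n : ℕ) (hn1 : 1 ≤ n) (_hn : n ≤ nScales β + 1) (_hreg : IsKLRegime U c (-(n : ℤ)))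
    (hhist : HistP klPredsV17F2 L M klEngGeo7 P (klEngQ7 P R) R β U μ 0 n)
    (_hfr : FrameOK R U (nScales β) μ (klFlowFrameU L M β U μ n))
    (_hN : KernelNormsV4 L M P (klEngQ7 P R) β U μ (klFlowFrameU L M β U μ n) n)
    (hlad : PairLadderStepAtV17F2 L M klEngGeo7 P (klEngQ7 P R) β U μ n)
    (hout : ∀ Qm : TorusSite 2 L, ¬ IsPairClassAt L Qm n → ∀ k ∈ klBall L μ 0, ∀ k' ∈ klBall L μ 0,
      ‖klPairAmplitude L M β U μ (klFlowFrameU L M β U μ n) n Qm k k' -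
          klPairAmplitude L M β U μ (klFlowFrameU L M β U μ (n - 1)) (n - 1) Qm k k'‖ ≤
        gainBar klEngGeo7 P U n (klTorusNorm L Qm) (klTorusNorm L (k - k')) (klTorusNorm L (k + k' - Qm)) +
          eremBar klEngGeo7 P (klEngQ7 P R) U β L (n - 1) + thermalBar klEngGeo7 P U β n +
            legDressBarQ2 klEngGeo7 P (klEngQ7 P R) U n (legSliceCountT L β μ (klFlowFrameU L M β U μ n) n ![k', Qm - k', Qm - k, k]) +
              frameShiftBar P (klEngQ7 P R) U n)
    (hE5 : IsoTupleL1AtV17F L M klEngGeo7 P β U μ n) :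
    PairLadderStepAtV17F2 L M klEngGeo7 P (klEngQ7 P R) β U μ n ∧ PairValueIncrementAtV17F L M klEngGeo7 P (klEngQ7 P R) β U μ n ∧
      QuarticValueIncrementAtV17F L M klEngGeo7 P (klEngQ7 P R) β U μ n ∧ IsoTupleL1AtV17F L M klEngGeo7 P β U μ n :=
  stepValuesV17F2_of_residue_Q hP hR.wf (klEngQ7_wf P R) rfl hU (klEngU₀9_le_klEngU₀4 P R c) hUle hn1 hhist hlad hout hE5

/-- **Stub (c) of the registered skeleton from (E2-F2)ₙ + out-of-class rows + the TOWER's single-tuple line** ((E5-F)ₙ by the door; the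
diagonal bare-ball point supplies the door's geometry from the stub's own binders `μ ∈ klWindowC`, `klEngL₃ β U ≤ L`). -/
theorem stepValuesV17F2_reg_of_residue_towerLine (P : SplitConsts) (R : RenConsts) (c : ℝ) (hP : P.WF) (hR : R.WF2) (_hc : 0 < c)
    (_hc3 : c ≤ klEngC₃6 P R) (μ : ℝ) (hμ : μ ∈ klWindowC) (U : ℝ) (hU : 0 < U) (hUle : U ≤ klEngU₀9 P R c) (β : ℝ)
    (hβ : klBetaMin ≤ β) (_hβc : β ≤ Real.exp (c / U ^ 2)) (L M : ℕ) [NeZero L] [NeZero M] (hL : klEngL₃ β U ≤ L)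
    (_hM : klEngM₃ β U L ≤ M) (n : ℕ) (hn1 : 1 ≤ n) (hn : n ≤ nScales β + 1) (_hreg : IsKLRegime U c (-(n : ℤ)))
    (hhist : HistP klPredsV17F2 L M klEngGeo7 P (klEngQ7 P R) R β U μ 0 n)
    (_hfr : FrameOK R U (nScales β) μ (klFlowFrameU L M β U μ n))
    (_hN : KernelNormsV4 L M P (klEngQ7 P R) β U μ (klFlowFrameU L M β U μ n) n)
    (hlad : PairLadderStepAtV17F2 L M klEngGeo7 P (klEngQ7 P R) β U μ n)
    (hout : ∀ Qm : TorusSite 2 L, ¬ IsPairClassAt L Qm n → ∀ k ∈ klBall L μ 0, ∀ k' ∈ klBall L μ 0,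
      ‖klPairAmplitude L M β U μ (klFlowFrameU L M β U μ n) n Qm k k' -
          klPairAmplitude L M β U μ (klFlowFrameU L M β U μ (n - 1)) (n - 1) Qm k k'‖ ≤
        gainBar klEngGeo7 P U n (klTorusNorm L Qm) (klTorusNorm L (k - k')) (klTorusNorm L (k + k' - Qm)) +
          eremBar klEngGeo7 P (klEngQ7 P R) U β L (n - 1) + thermalBar klEngGeo7 P U β n +
            legDressBarQ2 klEngGeo7 P (klEngQ7 P R) U n (legSliceCountT L β μ (klFlowFrameU L M β U μ n) n ![k', Qm - k', Qm - k, k]) +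
              frameShiftBar P (klEngQ7 P R) U n)
    {a b : ℝ}
    (hfix : ∀ m : ℕ, n ≤ m → ∀ Ω ∈ bgmSectorSet L M (klIsoFamily L M β μ (klFlowFrameU L M β U μ n) klE0 m) 4,
      ∀ x₁ : SpaceTimeIdx L M,
        fixedTupleL1 L M β 3 (klIsoKernelAt L M β U μ (klFlowFrameU L M β U μ n) n m) Ω x₁ ≤ a * U + b * (P.Klam * U) ^ 2)
    (ha : 2 * a ≤ klEngGeo7.CF) (hb : b ≤ klEngGeo7.CF) (hUκ : R.Gfr 0 * |U| ≤ 1 / 32 * klE0)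
    (hsmall : initDevBar klEngGeo7 U + legDressBarQ2 klEngGeo7 P (klEngQ7 P R) U 0 4 +
        (3 * klEngGeo7.CF * (P.Klam * U) ^ 2 +
          ((klEngGeo7.cloc * P.Klam ^ 2 * (1 - (4 : ℝ) ^ (-klEngGeo7.θ))⁻¹ + 2 * (klEngQ7 P R).CR * P.Klam ^ 3 * |U|) * U ^ 2 +
              ∑ j ∈ range n, (klEngQ7 P R).CL β j / L) +
            7 / 3 * (klEngGeo7.CF * (P.Klam * U) ^ 2) + 20 * ((klEngQ7 P R).CR * ((P.Klam * U) ^ 2 + (P.Klam * |U|) ^ 3)) +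
              4 / 3 * ((klEngQ7 P R).CR * (P.Klam * U) ^ 2)) ≤ U / 2) :
    PairLadderStepAtV17F2 L M klEngGeo7 P (klEngQ7 P R) β U μ n ∧ PairValueIncrementAtV17F L M klEngGeo7 P (klEngQ7 P R) β U μ n ∧
      QuarticValueIncrementAtV17F L M klEngGeo7 P (klEngQ7 P R) β U μ n ∧ IsoTupleL1AtV17F L M klEngGeo7 P β U μ n := by
  obtain ⟨q, hq, hqq⟩ := exists_mem_klBall_zero_diag_of_klEngL₃_le hμ hβ hL
  exact stepValuesV17F2_of_residue_towerLine_Q hP hR.wf (klEngQ7_wf P R) rfl hU (klEngU₀9_le_klEngU₀4 P R c) hUle hn1 hn hhist hlad hout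
    hfix ha hb hq hq hqq hUκ hsmall

/-- **`Q`-generic residual form with the LINEAR (E5-F)ₙ door** ((R46)(β): ONE condition `a + b·Klam²·U ≤ CF/2` instead of `2a ≤ CF ∧ b ≤ CF`). -/
theorem stepValuesV17F2_of_residue_towerLineLinear_Q {P : SplitConsts} {Q : EngConsts} {R : RenConsts} {c β U μ U₀ : ℝ} {n : ℕ}
    {L M : ℕ} [NeZero L] [NeZero M] (hP : P.WF) (hR : R.WF) (hQ : Q.WF) (hQCR : Q.CR = (klEngQ5 P R).CR) (hU : 0 < U)
    (hU₀ : U₀ ≤ klEngU₀4 P R c) (hUle : U ≤ U₀) (hn1 : 1 ≤ n) (hn : n ≤ nScales β + 1)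
    (hhist : HistP klPredsV17F2 L M klEngGeo7 P Q R β U μ 0 n)
    (hlad : PairLadderStepAtV17F2 L M klEngGeo7 P Q β U μ n)
    (hout : ∀ Qm : TorusSite 2 L, ¬ IsPairClassAt L Qm n → ∀ k ∈ klBall L μ 0, ∀ k' ∈ klBall L μ 0,
      ‖klPairAmplitude L M β U μ (klFlowFrameU L M β U μ n) n Qm k k' -
          klPairAmplitude L M β U μ (klFlowFrameU L M β U μ (n - 1)) (n - 1) Qm k k'‖ ≤
        gainBar klEngGeo7 P U n (klTorusNorm L Qm) (klTorusNorm L (k - k')) (klTorusNorm L (k + k' - Qm)) +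
          eremBar klEngGeo7 P Q U β L (n - 1) + thermalBar klEngGeo7 P U β n +
            legDressBarQ2 klEngGeo7 P Q U n (legSliceCountT L β μ (klFlowFrameU L M β U μ n) n ![k', Qm - k', Qm - k, k]) +
              frameShiftBar P Q U n)
    {a b : ℝ}
    (hfix : ∀ m : ℕ, n ≤ m → ∀ Ω ∈ bgmSectorSet L M (klIsoFamily L M β μ (klFlowFrameU L M β U μ n) klE0 m) 4,
      ∀ x₁ : SpaceTimeIdx L M,
        fixedTupleL1 L M β 3 (klIsoKernelAt L M β U μ (klFlowFrameU L M β U μ n) n m) Ω x₁ ≤ a * U + b * (P.Klam * U) ^ 2)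
    (hab : a + b * P.Klam ^ 2 * U ≤ klEngGeo7.CF / 2)
    {q q₃ : TorusSite 2 L} (hq : q ∈ klBall L μ 0) (hq₃ : q₃ ∈ klBall L μ 0) (hqq : 4⁻¹ < klTorusNorm L (q + q₃))
    (hUκ : R.Gfr 0 * |U| ≤ 1 / 32 * klE0)
    (hsmall : initDevBar klEngGeo7 U + legDressBarQ2 klEngGeo7 P Q U 0 4 +
        (3 * klEngGeo7.CF * (P.Klam * U) ^ 2 +
          ((klEngGeo7.cloc * P.Klam ^ 2 * (1 - (4 : ℝ) ^ (-klEngGeo7.θ))⁻¹ + 2 * Q.CR * P.Klam ^ 3 * |U|) * U ^ 2 +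
              ∑ j ∈ range n, Q.CL β j / L) +
            7 / 3 * (klEngGeo7.CF * (P.Klam * U) ^ 2) + 20 * (Q.CR * ((P.Klam * U) ^ 2 + (P.Klam * |U|) ^ 3)) +
              4 / 3 * (Q.CR * (P.Klam * U) ^ 2)) ≤ U / 2) :
    PairLadderStepAtV17F2 L M klEngGeo7 P Q β U μ n ∧ PairValueIncrementAtV17F L M klEngGeo7 P Q β U μ n ∧
      QuarticValueIncrementAtV17F L M klEngGeo7 P Q β U μ n ∧ IsoTupleL1AtV17F L M klEngGeo7 P β U μ n := by
  have harr : PairArrayAtV17F L M P Q β U μ (n - 1) :=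
    (((histP_klPredsV17F2_iff L M klEngGeo7 P Q R β U μ 0 n).1 hhist) (n - 1) (by omega)).1.1
  obtain ⟨hcU', hUb⟩ := klvrF_smallness_of_le_klEngU₀4 hP hR hQCR hU hU₀ hUle
  have hE2'' : PairValueIncrementAtV17F L M klEngGeo7 P Q β U μ n :=
    klvrF_pairValueIncrementAtV17F_of_inClass_outClass
      (fun Qm hQm => klvrF_pairValueIncrement_inClass_klEng7 hP hQ hn1 hlad harr hcU' hUb hQm) hout
  have hE5 : IsoTupleL1AtV17F L M klEngGeo7 P β U μ n :=
    isoTupleL1AtV17F_of_fixedTuple_le_linear_hist klEngGeo7_wf hP hQ hR hU hn1 hn hfix hab hhist hE2'' hq hq₃ hqq hUκ hsmall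
  exact klvrF_stepValues_of_reduced_klEng7 hP hQ hn1 hlad harr hcU' hUb hout hE5

/-- **Registered-token instance of the LINEAR tower-line form** (`(klEngGeo7, klEngQ7 P R, klEngU₀9)`, geometry from the stub's binders). -/
theorem stepValuesV17F2_reg_of_residue_towerLineLinear (P : SplitConsts) (R : RenConsts) (c : ℝ) (hP : P.WF) (hR : R.WF2)
    {μ : ℝ} (hμ : μ ∈ klWindowC) {U : ℝ} (hU : 0 < U) (hUle : U ≤ klEngU₀9 P R c) {β : ℝ} (hβ : klBetaMin ≤ β)
    {L M : ℕ} [NeZero L] [NeZero M] (hL : klEngL₃ β U ≤ L) {n : ℕ} (hn1 : 1 ≤ n) (hn : n ≤ nScales β + 1)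
    (hhist : HistP klPredsV17F2 L M klEngGeo7 P (klEngQ7 P R) R β U μ 0 n)
    (hlad : PairLadderStepAtV17F2 L M klEngGeo7 P (klEngQ7 P R) β U μ n)
    (hout : ∀ Qm : TorusSite 2 L, ¬ IsPairClassAt L Qm n → ∀ k ∈ klBall L μ 0, ∀ k' ∈ klBall L μ 0,
      ‖klPairAmplitude L M β U μ (klFlowFrameU L M β U μ n) n Qm k k' -
          klPairAmplitude L M β U μ (klFlowFrameU L M β U μ (n - 1)) (n - 1) Qm k k'‖ ≤
        gainBar klEngGeo7 P U n (klTorusNorm L Qm) (klTorusNorm L (k - k')) (klTorusNorm L (k + k' - Qm)) +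
          eremBar klEngGeo7 P (klEngQ7 P R) U β L (n - 1) + thermalBar klEngGeo7 P U β n +
            legDressBarQ2 klEngGeo7 P (klEngQ7 P R) U n (legSliceCountT L β μ (klFlowFrameU L M β U μ n) n ![k', Qm - k', Qm - k, k]) +
              frameShiftBar P (klEngQ7 P R) U n)
    {a b : ℝ}
    (hfix : ∀ m : ℕ, n ≤ m → ∀ Ω ∈ bgmSectorSet L M (klIsoFamily L M β μ (klFlowFrameU L M β U μ n) klE0 m) 4,
      ∀ x₁ : SpaceTimeIdx L M,
        fixedTupleL1 L M β 3 (klIsoKernelAt L M β U μ (klFlowFrameU L M β U μ n) n m) Ω x₁ ≤ a * U + b * (P.Klam * U) ^ 2)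
    (hab : a + b * P.Klam ^ 2 * U ≤ klEngGeo7.CF / 2) (hUκ : R.Gfr 0 * |U| ≤ 1 / 32 * klE0)
    (hsmall : initDevBar klEngGeo7 U + legDressBarQ2 klEngGeo7 P (klEngQ7 P R) U 0 4 +
        (3 * klEngGeo7.CF * (P.Klam * U) ^ 2 +
          ((klEngGeo7.cloc * P.Klam ^ 2 * (1 - (4 : ℝ) ^ (-klEngGeo7.θ))⁻¹ + 2 * (klEngQ7 P R).CR * P.Klam ^ 3 * |U|) * U ^ 2 +
              ∑ j ∈ range n, (klEngQ7 P R).CL β j / L) +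
            7 / 3 * (klEngGeo7.CF * (P.Klam * U) ^ 2) + 20 * ((klEngQ7 P R).CR * ((P.Klam * U) ^ 2 + (P.Klam * |U|) ^ 3)) +
              4 / 3 * ((klEngQ7 P R).CR * (P.Klam * U) ^ 2)) ≤ U / 2) :
    PairLadderStepAtV17F2 L M klEngGeo7 P (klEngQ7 P R) β U μ n ∧ PairValueIncrementAtV17F L M klEngGeo7 P (klEngQ7 P R) β U μ n ∧
      QuarticValueIncrementAtV17F L M klEngGeo7 P (klEngQ7 P R) β U μ n ∧ IsoTupleL1AtV17F L M klEngGeo7 P β U μ n := by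
  obtain ⟨q, hq, hqq⟩ := exists_mem_klBall_zero_diag_of_klEngL₃_le hμ hβ hL
  exact stepValuesV17F2_of_residue_towerLineLinear_Q hP hR.wf (klEngQ7_wf P R) rfl hU (klEngU₀9_le_klEngU₀4 P R c) hUle hn1 hn hhist hlad
    hout hfix hab hq hq hqq hUκ hsmall

/-- **Stub (c) of the registered skeleton in the THERMAL BAND from ONE sign-blind bound + (E5-F)ₙ** (`nScales β ≤ n + T`, `Cp·4^T ≤ 2^80`). -/
theorem stepValuesV17F2_reg_band_of_signBlind (P : SplitConsts) (R : RenConsts) (hP : P.WF) (μ U β : ℝ) (L M : ℕ) [NeZero L] [NeZero M]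
    (n : ℕ) (hn1 : 1 ≤ n) {T : ℕ} (hband : nScales β ≤ n + T) {Cp : ℝ} (hCp : 0 ≤ Cp) (hCpT : Cp * 4 ^ T ≤ 2 ^ 80)
    (hpair : ∀ Qm : TorusSite 2 L, ∀ k ∈ klBall L μ 0, ∀ k' ∈ klBall L μ 0,
      ‖klPairAmplitude L M β U μ (klFlowFrameU L M β U μ n) n Qm k k' -
          klPairAmplitude L M β U μ (klFlowFrameU L M β U μ (n - 1)) (n - 1) Qm k k'‖ ≤ Cp * (P.Klam * U) ^ 2)
    (hE5 : IsoTupleL1AtV17F L M klEngGeo7 P β U μ n) :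
    PairLadderStepAtV17F2 L M klEngGeo7 P (klEngQ7 P R) β U μ n ∧ PairValueIncrementAtV17F L M klEngGeo7 P (klEngQ7 P R) β U μ n ∧
      QuarticValueIncrementAtV17F L M klEngGeo7 P (klEngQ7 P R) β U μ n ∧ IsoTupleL1AtV17F L M klEngGeo7 P β U μ n :=
  stepValuesV17F2_band_of_signBlind_Q hP (klEngQ7_wf P R) hn1 hband hCp hCpT hpair hE5

/-- **The band with (E5-F)ₙ from the door** (stub's `μ ∈ klWindowC`, `klBetaMin ≤ β`, `klEngL₃ β U ≤ L` give the diagonal point). -/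
theorem stepValuesV17F2_reg_band_towerLine (P : SplitConsts) (R : RenConsts) (hP : P.WF) (hR : R.WF2) {μ U β : ℝ} (hμ : μ ∈ klWindowC)
    (hU : 0 < U) (hβ : klBetaMin ≤ β) {L M : ℕ} [NeZero L] [NeZero M] (hL : klEngL₃ β U ≤ L) {n : ℕ} (hn1 : 1 ≤ n)
    (hn : n ≤ nScales β + 1) {T : ℕ} (hband : nScales β ≤ n + T) {Cp : ℝ} (hCp : 0 ≤ Cp) (hCpT : Cp * 4 ^ T ≤ 2 ^ 80)
    (hpair : ∀ Qm : TorusSite 2 L, ∀ k ∈ klBall L μ 0, ∀ k' ∈ klBall L μ 0,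
      ‖klPairAmplitude L M β U μ (klFlowFrameU L M β U μ n) n Qm k k' -
          klPairAmplitude L M β U μ (klFlowFrameU L M β U μ (n - 1)) (n - 1) Qm k k'‖ ≤ Cp * (P.Klam * U) ^ 2)
    (hhist : HistP klPredsV17F2 L M klEngGeo7 P (klEngQ7 P R) R β U μ 0 n)
    {a b : ℝ}
    (hfix : ∀ m : ℕ, n ≤ m → ∀ Ω ∈ bgmSectorSet L M (klIsoFamily L M β μ (klFlowFrameU L M β U μ n) klE0 m) 4,
      ∀ x₁ : SpaceTimeIdx L M,
        fixedTupleL1 L M β 3 (klIsoKernelAt L M β U μ (klFlowFrameU L M β U μ n) n m) Ω x₁ ≤ a * U + b * (P.Klam * U) ^ 2)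
    (ha : 2 * a ≤ klEngGeo7.CF) (hb : b ≤ klEngGeo7.CF) (hUκ : R.Gfr 0 * |U| ≤ 1 / 32 * klE0)
    (hsmall : initDevBar klEngGeo7 U + legDressBarQ2 klEngGeo7 P (klEngQ7 P R) U 0 4 +
        (3 * klEngGeo7.CF * (P.Klam * U) ^ 2 +
          ((klEngGeo7.cloc * P.Klam ^ 2 * (1 - (4 : ℝ) ^ (-klEngGeo7.θ))⁻¹ + 2 * (klEngQ7 P R).CR * P.Klam ^ 3 * |U|) * U ^ 2 +
              ∑ j ∈ range n, (klEngQ7 P R).CL β j / L) +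
            7 / 3 * (klEngGeo7.CF * (P.Klam * U) ^ 2) + 20 * ((klEngQ7 P R).CR * ((P.Klam * U) ^ 2 + (P.Klam * |U|) ^ 3)) +
              4 / 3 * ((klEngQ7 P R).CR * (P.Klam * U) ^ 2)) ≤ U / 2) :
    PairLadderStepAtV17F2 L M klEngGeo7 P (klEngQ7 P R) β U μ n ∧ PairValueIncrementAtV17F L M klEngGeo7 P (klEngQ7 P R) β U μ n ∧
      QuarticValueIncrementAtV17F L M klEngGeo7 P (klEngQ7 P R) β U μ n ∧ IsoTupleL1AtV17F L M klEngGeo7 P β U μ n := by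
  obtain ⟨q, hq, hqq⟩ := exists_mem_klBall_zero_diag_of_klEngL₃_le hμ hβ hL
  exact stepValuesV17F2_band_towerLine_Q hP (klEngQ7_wf P R) hR.wf hU hn1 hn hband hCp hCpT hpair hhist hfix ha hb hq hq hqq hUκ hsmall

end Summit.HubbardSuperconductivity.HubbardSuperconductivity.Theorems.KLRegimeSplit

end
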